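import Summits.Parity.GeneralizedHardyLittlewood.Theses.ParityLeakOneFifth
import Literature.NumberTheory.Sieve.IntervalResidueClassSieve
import Summits.Parity.GeneralizedHardyLittlewood.Theorems.ParityLeakOneFifthPlainSplitRoughMass
import Summits.Parity.GeneralizedHardyLittlewood.Theorems.ParityLeakOneFifthPlainSplitRoughLiouville
import Summits.Parity.GeneralizedHardyLittlewood.Theorems.ParityLeakOneFifthPlainSplitCalibTools
import Summits.Parity.GeneralizedHardyLittlewood.Theorems.ParityLeakOneFifthPlainSplitTwistedPrimesLower
import Summits.Parity.GeneralizedHardyLittlewood.Theorems.ParityLeakOneFifthPlainSplitTwistedBoundaryUpper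
import Summits.Parity.GeneralizedHardyLittlewood.Theorems.ParityLeakOneFifthPlainSplitTwistedE3Upper
import Summits.Parity.GeneralizedHardyLittlewood.Theorems.ParityLeakOneFifthPlainSplitCalibReduction
import HarnessLib

/-!
# Route ParityLeakOneFifth, crux `PlainSplit` (stmt-Parity-18382): the composition modulo the last stub

`PlainSplit : CalibratedE1 → PintzDensity → E1NonSaturation`, proved.  Line `calib-split`
(skeleton v2 of the birth skeleton): the calibration lower bound `Π(ε, x) ≥ x/(100 log x)`
(`calibrationLowerBound`) is assembled from the five landed stubs `stub_calibReduction`,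
`stub_twistedPrimesLower`, `stub_twistedE3Upper`, `stub_twistedBoundaryUpper`,
and the statement of `stub_roughLiouvilleTwistedSmall` taken as a hypothesis (arithmetic
`calib_arith2`, growth `200x^{4/5} ≤ Vx/(100 log x)`), and the three-line split (`assembly_abstract`:
K2 + K1 + model mass `stub_roughMass` + rough Liouville `stub_roughLiouville` + calibration) gives
the route decl BY NAME modulo that hypothesis (`plainSplit_of_twisted`); the closing file
`ParityLeakOneFifthPlainSplit.lean` discharges it.
-/

namespace Summit.Parity.GeneralizedHardyLittlewood.Theorems.ParityLeakOneFifth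

open Finset

/-- The arithmetic of the assembly over real variables: `P − B₂ − 2E₃ − 200X + A_w ≤ S`,
`P ≥ (99/100)Y₁`, `E₃ ≤ (23/50 + 1/100)Y₁`, `B₂ ≤ CεY₁`, `A_w ≥ −Y₂/100`, `200X ≤ Y₂/100`,
`Cε ≤ 1/50`, `Y₂ ≤ Y₁` (`Y₁ = V_sh x/log x`, `Y₂ = V x/log x`) give `Y₂/100 ≤ S`. -/
theorem calib_arith2 {Vsh V xr L C ε P B2 E3 Aw S X45 : ℝ}
    (hR : P - B2 - 2 * E3 - 200 * X45 + Aw ≤ S)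
    (hP : (1 - 1 / 100) * Vsh * xr / L ≤ P) (hE : E3 ≤ (23 / 50 + 1 / 100) * Vsh * xr / L)
    (hB : B2 ≤ C * ε * Vsh * xr / L) (hA : -(1 / 100 * V * xr / L) ≤ Aw)
    (hg : 200 * X45 ≤ 1 / 100 * V * xr / L) (hCε : C * ε ≤ 1 / 50) (hVVsh : V ≤ Vsh)
    (hx : 0 < xr) (hL : 0 < L) (hV : 0 ≤ V) : 1 / 100 * xr / L * V ≤ S := by
  set Y₁ : ℝ := Vsh * xr / L with hY₁
  set Y₂ : ℝ := V * xr / L with hY₂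
  have hY₂0 : 0 ≤ Y₂ := div_nonneg (mul_nonneg hV hx.le) hL.le
  have hY : Y₂ ≤ Y₁ := div_le_div_of_nonneg_right (mul_le_mul_of_nonneg_right hVVsh hx.le) hL.le
  have hY₁0 : 0 ≤ Y₁ := hY₂0.trans hY
  have hCY : C * ε * Vsh * xr / L ≤ 1 / 50 * Y₁ := by
    rw [hY₁, show C * ε * Vsh * xr / L = (C * ε) * (Vsh * xr / L) by ring]
    exact mul_le_mul_of_nonneg_right hCε hY₁0
  have e1 : (1 - 1 / 100) * Vsh * xr / L = (1 - 1 / 100) * Y₁ := by rw [hY₁]; ring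
  have e2 : (23 / 50 + 1 / 100) * Vsh * xr / L = (23 / 50 + 1 / 100) * Y₁ := by rw [hY₁]; ring
  have e3 : 1 / 100 * V * xr / L = 1 / 100 * Y₂ := by rw [hY₂]; ring
  have e4 : 1 / 100 * xr / L * V = 1 / 100 * Y₂ := by rw [hY₂]; ring
  rw [e1] at hP
  rw [e2] at hE
  rw [e3] at hA hg
  rw [e4]
  linarith


/-- **The calibration lower bound** (`Birth.Sig.stub_calibrationLowerBound` with `c₀ = 1/100`),
from the four landed stubs and the statement of `stub_roughLiouvilleTwistedSmall`: with `δ = 1/100`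
in the prime, `Ω = 3` and Liouville inputs and `ε₁ = min(ε₀, ε₀', 1/(50C), 1/25)`,
`VΠ ≥ (99/100 − 2(23/50 + 1/100) − Cε) V_sh x/log x − V x/(100 log x) − 200 x^{4/5} ≥ V x/(100 log x)`
(`V_sh ≥ V`, `200 x^{4/5} ≤ V x/(100 log x)` by `V ≥ c/(log z)²` and growth). -/
theorem calibrationLowerBound_of_twisted
    (hA : ∀ δ : ℝ, 0 < δ → ∃ ε₀ : ℝ, 0 < ε₀ ∧ ∀ ε : ℝ, 0 < ε → ε ≤ ε₀ → ∃ x₀ : ℕ, ∀ x : ℕ, x₀ ≤ x → ∀ (z V : ℝ) (G : ℕ → ℝ), z = Real.exp (Real.log (Real.log (x : ℝ)) ^ 2) → V = ∏ p ∈ (Finset.range ⌈z⌉₊).filter Nat.Prime, (1 - 1 / (p : ℝ)) → G = (fun m : ℕ => ∑ d ∈ (Nat.divisors m).filter (fun d : ℕ => (d : ℝ) ≤ (x : ℝ) ^ ((1 : ℝ) / 2 - 2 * ε) ∧ ∀ p ∈ d.primeFactors, (x : ℝ) ^ ((1 : ℝ) / 5) ≤ (p : ℝ)), (ArithmeticFunction.moebius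 d : ℝ)) → |∑ n ∈ (Finset.Ioc x (2 * x)).filter (fun n : ℕ => (∀ p ∈ n.primeFactors, z ≤ (p : ℝ)) ∧ (x : ℝ) ^ (ε ^ 2) ≤ ((n + 2).minFac : ℝ)), (ArithmeticFunction.liouville (n + 2) : ℝ) * G (n + 2)| ≤ δ * V * (x : ℝ) / Real.log (x : ℝ)) :
    ∃ ε₁ : ℝ, 0 < ε₁ ∧ ∀ ε : ℝ, 0 < ε → ε ≤ ε₁ → ∃ c₀ : ℝ, 0 < c₀ ∧ ∃ x₀ : ℕ, ∀ x : ℕ, x₀ ≤ x → ∀ (z V : ℝ) (b Φ : ℕ → ℝ), z = Real.exp (Real.log (Real.log (x : ℝ)) ^ 2) → V = ∏ p ∈ (Finset.range ⌈z⌉₊).filter Nat.Prime, (1 - 1 / (p : ℝ)) → b = (fun n : ℕ => if ∀ p ∈ n.primeFactors, z ≤ (p : ℝ) then 1 / V else 0) → Φ = (fun m : ℕ => if (x : ℝ) ^ (ε ^ 2) ≤ (m.minFac : ℝ) ∧ (m.minFac : ℝ) < (x : ℝ) ^ ((1 : ℝ) / 5) then ∑ d ∈ (Nat.divisors m).filter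 (fun d : ℕ => (d : ℝ) ≤ (x : ℝ) ^ ((1 : ℝ) / 2 - 2 * ε) ∧ ∀ p ∈ d.primeFactors, (x : ℝ) ^ ((1 : ℝ) / 5) ≤ (p : ℝ)), (ArithmeticFunction.moebius d : ℝ) else 0) → c₀ * (x : ℝ) / Real.log (x : ℝ) ≤ ∑ n ∈ Finset.Ioc x (2 * x), b n * (ArithmeticFunction.liouville (n + 2) : ℝ) * Φ (n + 2) := by
  have hR := stub_calibReduction
  have hP := stub_twistedPrimesLower
  have hE := stub_twistedE3Upper
  have hB := stub_twistedBoundaryUpper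
  obtain ⟨C, hC, ε₀, hε₀, hB⟩ := hB
  obtain ⟨ε₀', hε₀', hA⟩ := hA (1 / 100) (by norm_num)
  obtain ⟨c, hc, hVlow⟩ :=
    Literature.NumberTheory.Sieve.IntervalClassSieve.le_prod_one_sub_card_div 1
  refine ⟨min (min ε₀ ε₀') (min (1 / (50 * C)) (1 / 25)), by positivity, ?_⟩
  intro ε hε hεle
  have hεε₀ : ε ≤ ε₀ := hεle.trans ((min_le_left _ _).trans (min_le_left _ _))
  have hεε₀' : ε ≤ ε₀' := hεle.trans ((min_le_left _ _).trans (min_le_right _ _))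
  have hεC : ε ≤ 1 / (50 * C) := hεle.trans ((min_le_right _ _).trans (min_le_left _ _))
  have hε25 : ε ≤ 1 / 25 := hεle.trans ((min_le_right _ _).trans (min_le_right _ _))
  have hCε : C * ε ≤ 1 / 50 := by
    calc C * ε ≤ C * (1 / (50 * C)) := mul_le_mul_of_nonneg_left hεC hC.le
      _ = 1 / 50 := by field_simp
  obtain ⟨x₁, hx₁⟩ := hR ε hε hε25
  obtain ⟨x₂, hx₂⟩ := hP (1 / 100) (by norm_num)
  obtain ⟨x₃, hx₃⟩ := hE (1 / 100) (by norm_num)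
  obtain ⟨x₄, hx₄⟩ := hB ε hε hεε₀
  obtain ⟨x₅, hx₅⟩ := hA ε hε hεε₀'
  -- growth: `200 x^{4/5} ≤ (1/100) V x / log x`
  obtain ⟨T, hT1, hT⟩ := exists_quadratic_le_exp 0 25 (5 * Real.log (20000 / c))
  obtain ⟨x₆, hx₆⟩ := exists_nat_loglog_ge T
  refine ⟨1 / 100, by norm_num, max (max (max x₁ x₂) (max x₃ x₄)) (max x₅ x₆), ?_⟩
  intro x hx
  rintro z V b Φ rfl rfl rfl rfl
  simp only [max_le_iff] at hx
  obtain ⟨⟨⟨hx1, hx2⟩, hx3, hx4⟩, hx5, hx6⟩ := hx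
  obtain ⟨hxE, hlogx, hTt⟩ := hx₆ x hx6
  -- the parameters
  set t : ℝ := Real.log (Real.log (x : ℝ)) with ht
  have ht1 : 1 ≤ t := hT1.trans hTt
  have ht0 : 0 ≤ t := by linarith
  have hx0 : (0 : ℝ) < x := (Real.exp_pos _).trans_le hxE
  have hlogpos : 0 < Real.log (x : ℝ) := (Real.exp_pos _).trans_le hlogx
  have hexpt : Real.exp t = Real.log (x : ℝ) := by rw [ht, Real.exp_log hlogpos]
  have hxexp : Real.exp (Real.exp t) = (x : ℝ) := by rw [hexpt, Real.exp_log hx0]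
  set z : ℝ := Real.exp (t ^ 2) with hz
  have hz2 : 2 < z := by
    have h1 : Real.exp 1 ≤ z := Real.exp_le_exp.2 (by nlinarith)
    have h2 : (2 : ℝ) < Real.exp 1 := by have := Real.exp_one_gt_d9; linarith
    linarith
  have hlogz : Real.log z = t ^ 2 := by rw [hz, Real.log_exp]
  set V : ℝ := ∏ p ∈ (Finset.range ⌈z⌉₊).filter Nat.Prime, (1 - 1 / (p : ℝ)) with hV
  set Vsh : ℝ := ∏ p ∈ (Finset.range ⌈z⌉₊).filter (fun p : ℕ => p.Prime ∧ p ≠ 2),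
    (1 - 1 / ((p : ℝ) - 1)) with hVsh
  -- `V ≥ c / t⁴ > 0` and `V ≤ Vsh`
  have hVc : c / t ^ 4 ≤ V := by
    have hPB : Nat.primesBelow ⌈z⌉₊ = (Finset.range ⌈z⌉₊).filter Nat.Prime := rfl
    have h := hVlow (fun p => {(p - x % p) % p}) (fun p _ => by rw [Finset.card_singleton])
      (fun p hp => by rw [Finset.card_singleton]; exact hp.one_lt) z hz2.le
    rw [hPB, hlogz] at h
    have e : (t ^ 2) ^ (2 * 1) = t ^ 4 := by ring
    rw [e] at h
    refine h.trans (le_of_eq (Finset.prod_congr rfl fun p _ => ?_))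
    rw [Finset.card_singleton, Nat.cast_one]
  have ht4 : 0 < t ^ 4 := by positivity
  have hV0 : 0 < V := lt_of_lt_of_le (div_pos hc ht4) hVc
  have hVVsh : V ≤ Vsh := V_le_Vsh hz2
  -- instantiate the stubs
  set G : ℕ → ℝ := fun m : ℕ => ∑ d ∈ (Nat.divisors m).filter (fun d : ℕ =>
    (d : ℝ) ≤ (x : ℝ) ^ ((1 : ℝ) / 2 - 2 * ε) ∧ ∀ p ∈ d.primeFactors,
      (x : ℝ) ^ ((1 : ℝ) / 5) ≤ (p : ℝ)), (ArithmeticFunction.moebius d : ℝ) with hG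
  set ΦL : ℕ → ℝ := fun m : ℕ => if (x : ℝ) ^ (ε ^ 2) ≤ (m.minFac : ℝ) ∧
      (m.minFac : ℝ) < (x : ℝ) ^ ((1 : ℝ) / 5) then ∑ d ∈ (Nat.divisors m).filter (fun d : ℕ =>
        (d : ℝ) ≤ (x : ℝ) ^ ((1 : ℝ) / 2 - 2 * ε) ∧ ∀ p ∈ d.primeFactors,
          (x : ℝ) ^ ((1 : ℝ) / 5) ≤ (p : ℝ)), (ArithmeticFunction.moebius d : ℝ) else 0 with hΦL
  have hΦG : ΦL = fun m : ℕ => if (x : ℝ) ^ (ε ^ 2) ≤ (m.minFac : ℝ) ∧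
      (m.minFac : ℝ) < (x : ℝ) ^ ((1 : ℝ) / 5) then G m else 0 := by
    funext m; rfl
  set bL : ℕ → ℝ := fun n : ℕ => if ∀ p ∈ n.primeFactors, z ≤ (p : ℝ) then 1 / V else 0 with hbL
  have hR' := hx₁ x hx1 z G ΦL rfl rfl hΦG
  have hP' := hx₂ x hx2 z Vsh rfl rfl
  have hE' := hx₃ x hx3 z Vsh rfl rfl
  have hB' := hx₄ x hx4 z Vsh rfl rfl
  have hA' := abs_le.1 (hx₅ x hx5 z V G rfl rfl rfl)
  -- growth: `200 x^{4/5} ≤ (1/100) V x / log x`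
  have hgrowth : 200 * (x : ℝ) ^ ((4 : ℝ) / 5) ≤ 1 / 100 * V * (x : ℝ) / Real.log (x : ℝ) := by
    have hx45 : (x : ℝ) ^ ((4 : ℝ) / 5) = Real.exp (4 / 5 * Real.exp t) := by
      rw [← hxexp, ← Real.exp_mul]; ring_nf
    have h1 : t ^ 4 ≤ Real.exp (4 * t) := by
      have h := Real.add_one_le_exp t
      have h' : t ≤ Real.exp t := by linarith
      calc t ^ 4 ≤ (Real.exp t) ^ 4 := pow_le_pow_left₀ ht0 h' 4
        _ = Real.exp (4 * t) := by rw [← Real.exp_nat_mul]; norm_num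
    have h2 := hT t hTt
    have hc48 : 0 < 20000 / c := by positivity
    have key : 20000 * t ^ 4 * Real.exp t ≤ c * Real.exp (Real.exp t / 5) := by
      have h3 : Real.exp (Real.log (20000 / c) + 5 * t) ≤ Real.exp (Real.exp t / 5) :=
        Real.exp_le_exp.2 (by linarith)
      rw [Real.exp_add, Real.exp_log hc48] at h3
      have h4 : 20000 * t ^ 4 * Real.exp t ≤ 20000 * Real.exp (5 * t) := by
        have : t ^ 4 * Real.exp t ≤ Real.exp (4 * t) * Real.exp t :=
          mul_le_mul_of_nonneg_right h1 (Real.exp_pos t).le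
        rw [← Real.exp_add, show 4 * t + t = 5 * t by ring] at this
        linarith
      have h5 : 20000 * Real.exp (5 * t) = c * (20000 / c * Real.exp (5 * t)) := by
        field_simp
      rw [h5] at h4
      exact h4.trans (mul_le_mul_of_nonneg_left h3 hc.le)
    have hL : Real.log (x : ℝ) = Real.exp t := hexpt.symm
    rw [hx45, hL, ← hxexp]
    have hVx : 1 / 100 * (c / t ^ 4) * Real.exp (Real.exp t) / Real.exp t ≤
        1 / 100 * V * Real.exp (Real.exp t) / Real.exp t := by
      have := mul_le_mul_of_nonneg_right hVc
        (by positivity : (0 : ℝ) ≤ 1 / 100 * Real.exp (Real.exp t) / Real.exp t)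
      calc 1 / 100 * (c / t ^ 4) * Real.exp (Real.exp t) / Real.exp t
          = c / t ^ 4 * (1 / 100 * Real.exp (Real.exp t) / Real.exp t) := by ring
        _ ≤ V * (1 / 100 * Real.exp (Real.exp t) / Real.exp t) := this
        _ = 1 / 100 * V * Real.exp (Real.exp t) / Real.exp t := by ring
    refine le_trans ?_ hVx
    rw [le_div_iff₀ (Real.exp_pos t)]
    have hsplitexp : Real.exp (Real.exp t) =
        Real.exp (Real.exp t / 5) * Real.exp (4 / 5 * Real.exp t) := by
      rw [← Real.exp_add]; ring_nf
    rw [hsplitexp]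
    have hpos : 0 < Real.exp (4 / 5 * Real.exp t) := Real.exp_pos _
    have key' : 200 * Real.exp t ≤ 1 / 100 * (c / t ^ 4) * Real.exp (Real.exp t / 5) := by
      rw [show 1 / 100 * (c / t ^ 4) * Real.exp (Real.exp t / 5) =
        (c * Real.exp (Real.exp t / 5)) / (100 * t ^ 4) by field_simp]
      rw [le_div_iff₀ (by positivity)]
      nlinarith [key]
    have hfin := mul_le_mul_of_nonneg_right key' hpos.le
    calc 200 * Real.exp (4 / 5 * Real.exp t) * Real.exp t
        = 200 * Real.exp t * Real.exp (4 / 5 * Real.exp t) := by ring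
      _ ≤ 1 / 100 * (c / t ^ 4) * Real.exp (Real.exp t / 5) * Real.exp (4 / 5 * Real.exp t) := hfin
      _ = 1 / 100 * (c / t ^ 4) * (Real.exp (Real.exp t / 5) * Real.exp (4 / 5 * Real.exp t)) := by
          ring
  -- the model sum is `(1/V)·Σ_{rough} λ Φ`
  have hgoal : ∑ n ∈ Finset.Ioc x (2 * x), bL n * (ArithmeticFunction.liouville (n + 2) : ℝ) *
      ΦL (n + 2) = 1 / V * ∑ n ∈ (Finset.Ioc x (2 * x)).filter
        (fun n : ℕ => ∀ p ∈ n.primeFactors, z ≤ (p : ℝ)),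
          (ArithmeticFunction.liouville (n + 2) : ℝ) * ΦL (n + 2) := by
    simp only [hbL]
    exact sum_model_mul_eq x z V ΦL
  rw [hgoal]
  set S : ℝ := ∑ n ∈ (Finset.Ioc x (2 * x)).filter (fun n : ℕ => ∀ p ∈ n.primeFactors, z ≤ (p : ℝ)),
    (ArithmeticFunction.liouville (n + 2) : ℝ) * ΦL (n + 2) with hSdef
  have hVne : V ≠ 0 := hV0.ne'
  have hVinv : 0 ≤ 1 / V := (one_div_pos.2 hV0).le
  suffices key : 1 / 100 * (x : ℝ) / Real.log (x : ℝ) * V ≤ S by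
    calc 1 / 100 * (x : ℝ) / Real.log (x : ℝ)
        = (1 / 100 * (x : ℝ) / Real.log (x : ℝ) * V) * (1 / V) := by
          rw [one_div V, mul_inv_cancel_right₀ hVne]
      _ ≤ S * (1 / V) := mul_le_mul_of_nonneg_right key hVinv
      _ = 1 / V * S := by ring
  -- assemble the inequalities
  exact calib_arith2 hR' hP' hE' hB' hA'.1 hgrowth hCε hVVsh hx0 hlogpos hV0.le


/-- **The three-line split, abstractly.** For real sequences `W, P` (indexed by `ε, x`) and
`B, W_λ, S, L` (indexed by `x`) with `W_λ = S − L`: K2 (`W − (P/B) W_λ ≤ θ x/log x` for every `θ > 0`,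
eventually), K1 (`S ≤ κ x`, `κ < 1`), `B = (1 + o(1)) x`, `L = o(x)` and `P ≥ c₀(ε) x / log x` give
`W ≤ (1 − η) P` eventually, with `η = (1 − max κ 0)/3`. -/
theorem assembly_abstract {W P : ℝ → ℕ → ℝ} {Bf Wlf Sf Lf : ℕ → ℝ}
    (hWl : ∀ x, Wlf x = Sf x - Lf x)
    (hB : ∀ δ : ℝ, 0 < δ → ∃ x₀ : ℕ, ∀ x : ℕ, x₀ ≤ x → |Bf x - (x : ℝ)| ≤ δ * (x : ℝ))
    (hL : ∀ δ : ℝ, 0 < δ → ∃ x₀ : ℕ, ∀ x : ℕ, x₀ ≤ x → |Lf x| ≤ δ * (x : ℝ))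
    (hP : ∃ ε₁ : ℝ, 0 < ε₁ ∧ ∀ ε : ℝ, 0 < ε → ε ≤ ε₁ → ∃ c₀ : ℝ, 0 < c₀ ∧ ∃ x₀ : ℕ, ∀ x : ℕ, x₀ ≤ x →
      c₀ * (x : ℝ) / Real.log (x : ℝ) ≤ P ε x)
    (hK2 : ∃ ε₁ : ℝ, 0 < ε₁ ∧ ∀ ε : ℝ, 0 < ε → ε ≤ ε₁ → ∀ θ : ℝ, 0 < θ → ∃ x₀ : ℕ, ∀ x : ℕ, x₀ ≤ x →
      W ε x - P ε x / Bf x * Wlf x ≤ θ * (x : ℝ) / Real.log (x : ℝ))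
    (hK1 : ∃ κ : ℝ, κ < 1 ∧ ∃ x₀ : ℕ, ∀ x : ℕ, x₀ ≤ x → Sf x ≤ κ * (x : ℝ)) :
    ∃ η : ℝ, 0 < η ∧ ∃ ε₁ : ℝ, 0 < ε₁ ∧ ∀ ε : ℝ, 0 < ε → ε ≤ ε₁ → ∃ x₀ : ℕ, ∀ x : ℕ, x₀ ≤ x →
      W ε x ≤ (1 - η) * P ε x := by
  obtain ⟨ε₁, hε₁, hK2⟩ := hK2
  obtain ⟨κ, hκ, xK, hK1⟩ := hK1
  obtain ⟨ε₂, hε₂, hP⟩ := hP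
  -- the slack `s = 1 − κ₊ ∈ (0, 1]`, `κ₊ = max κ 0`
  obtain ⟨s, hs⟩ : ∃ s : ℝ, s = 1 - max κ 0 := ⟨_, rfl⟩
  have hs0 : 0 < s := by
    have : max κ 0 < 1 := max_lt hκ one_pos
    linarith
  have hs1 : s ≤ 1 := by
    have : (0 : ℝ) ≤ max κ 0 := le_max_right _ _
    linarith
  refine ⟨s / 3, by positivity, min ε₁ ε₂, lt_min hε₁ hε₂, ?_⟩
  intro ε hε hεle
  obtain ⟨c₀, hc₀, xP, hPx⟩ := hP ε hε (hεle.trans (min_le_right _ _))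
  obtain ⟨xW, hWx⟩ := hK2 ε hε (hεle.trans (min_le_left _ _)) (c₀ * s / 3) (by positivity)
  obtain ⟨xB, hBx⟩ := hB (s / 6) (by positivity)
  obtain ⟨xL, hLx⟩ := hL (s / 6) (by positivity)
  refine ⟨max (max (max xK xP) (max xW xB)) (max xL 2), ?_⟩
  intro x hx
  simp only [max_le_iff] at hx
  obtain ⟨⟨⟨hxK, hxP⟩, hxW, hxB⟩, hxL, hx2⟩ := hx
  have hx1 : (1 : ℝ) < (x : ℝ) := by exact_mod_cast (lt_of_lt_of_le (by norm_num) hx2 : 1 < x)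
  have hxpos : (0 : ℝ) < (x : ℝ) := by linarith
  have hlog : 0 < Real.log (x : ℝ) := Real.log_pos hx1
  have h1 := hWx x hxW
  have h2 := hPx x hxP
  have h3 := abs_le.mp (hBx x hxB)
  have h4 := abs_le.mp (hLx x hxL)
  have h5 := hK1 x hxK
  -- positivity of `Π` and of the model mass `B`
  have hquot : 0 < c₀ * (x : ℝ) / Real.log (x : ℝ) := div_pos (mul_pos hc₀ hxpos) hlog
  have hPpos : 0 < P ε x := lt_of_lt_of_le hquot h2
  have hBlow : (1 - s / 6) * (x : ℝ) ≤ Bf x := by linarith [h3.1]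
  have hBpos : 0 < Bf x := lt_of_lt_of_le (mul_pos (by linarith) hxpos) hBlow
  -- `W_λ = S − L ≤ (κ₊ + s/6) x = (1 − s + s/6) x`
  have hSf : Sf x ≤ (1 - s) * (x : ℝ) := by
    have hk : κ * (x : ℝ) ≤ max κ 0 * (x : ℝ) := mul_le_mul_of_nonneg_right (le_max_left _ _) hxpos.le
    have e : (1 - s) = max κ 0 := by rw [hs]; ring
    rw [e]
    exact h5.trans hk
  have hWl' : Wlf x ≤ (1 - s + s / 6) * (x : ℝ) := by
    rw [hWl]
    linarith [h4.1]
  -- `t₁ = Π / B ≥ 0` and the middle term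
  have ht : 0 ≤ P ε x / Bf x := div_nonneg hPpos.le hBpos.le
  have h6 : P ε x / Bf x * Wlf x ≤ P ε x / Bf x * ((1 - s + s / 6) * (x : ℝ)) :=
    mul_le_mul_of_nonneg_left hWl' ht
  have h7 : (1 - s + s / 6) * (x : ℝ) ≤ (1 - s + s / 3) * Bf x := by
    have h7a : (1 - s + s / 3) * ((1 - s / 6) * (x : ℝ)) ≤ (1 - s + s / 3) * Bf x :=
      mul_le_mul_of_nonneg_left hBlow (by linarith)
    nlinarith [h7a, mul_nonneg (mul_nonneg hs0.le hs0.le) hxpos.le]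
  have h8 : P ε x / Bf x * ((1 - s + s / 6) * (x : ℝ)) ≤ P ε x / Bf x * ((1 - s + s / 3) * Bf x) :=
    mul_le_mul_of_nonneg_left h7 ht
  have h9 : P ε x / Bf x * ((1 - s + s / 3) * Bf x) = (1 - s + s / 3) * P ε x := by
    have hBne : Bf x ≠ 0 := hBpos.ne'
    calc P ε x / Bf x * ((1 - s + s / 3) * Bf x) = (1 - s + s / 3) * (P ε x * (Bf x / Bf x)) := by ring
      _ = (1 - s + s / 3) * P ε x := by rw [div_self hBne, mul_one]
  -- the `θ`-term
  have h10 : c₀ * s / 3 * (x : ℝ) / Real.log (x : ℝ) ≤ s / 3 * P ε x := by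
    have h10a := mul_le_mul_of_nonneg_left h2 (by positivity : (0 : ℝ) ≤ s / 3)
    calc c₀ * s / 3 * (x : ℝ) / Real.log (x : ℝ) = s / 3 * (c₀ * (x : ℝ) / Real.log (x : ℝ)) := by ring
      _ ≤ s / 3 * P ε x := h10a
  have h11 : W ε x ≤ c₀ * s / 3 * (x : ℝ) / Real.log (x : ℝ) + P ε x / Bf x * Wlf x := by linarith
  calc W ε x ≤ s / 3 * P ε x + (1 - s + s / 3) * P ε x := by linarith [h6, h8, h9, h10, h11]
    _ = (1 - s / 3) * P ε x := by ring


/-- **The crux `PlainSplit` modulo the last stub** (route `ParityLeakOneFifth`, stmt-Parity-18382):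
the statement of `stub_roughLiouvilleTwistedSmall` implies `CalibratedE1 → PintzDensity → E1NonSaturation`
BY NAME. -/
theorem plainSplit_of_twisted
    (hA : ∀ δ : ℝ, 0 < δ → ∃ ε₀ : ℝ, 0 < ε₀ ∧ ∀ ε : ℝ, 0 < ε → ε ≤ ε₀ → ∃ x₀ : ℕ, ∀ x : ℕ, x₀ ≤ x → ∀ (z V : ℝ) (G : ℕ → ℝ), z = Real.exp (Real.log (Real.log (x : ℝ)) ^ 2) → V = ∏ p ∈ (Finset.range ⌈z⌉₊).filter Nat.Prime, (1 - 1 / (p : ℝ)) → G = (fun m : ℕ => ∑ d ∈ (Nat.divisors m).filter (fun d : ℕ => (d : ℝ) ≤ (x : ℝ) ^ ((1 : ℝ) / 2 - 2 * ε) ∧ ∀ p ∈ d.primeFactors, (x : ℝ) ^ ((1 : ℝ) / 5) ≤ (p : ℝ)), (ArithmeticFunction.moebius d : ℝ)) → |∑ n ∈ (Finset.Ioc x (2 * x)).filter (fun n : ℕ => (∀ p ∈ n.primeFactors, z ≤ (p : ℝ)) ∧ (x : ℝ) ^ (ε ^ 2) ≤ ((n + 2).minFac : ℝ)), (ArithmeticFunction.liouville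 (n + 2) : ℝ) * G (n + 2)| ≤ δ * V * (x : ℝ) / Real.log (x : ℝ)) :
    Summit.Parity.GeneralizedHardyLittlewood.Theses.ParityLeakOneFifth.PlainSplit := by
  intro hK2 hK1
  have hB : ∀ δ : ℝ, 0 < δ → ∃ x₀ : ℕ, ∀ x : ℕ, x₀ ≤ x →
      |(fun x : ℕ => ∑ n ∈ Finset.Ioc x (2 * x), (fun n : ℕ => if ∀ p ∈ n.primeFactors, Real.exp (Real.log (Real.log (x : ℝ)) ^ 2) ≤ (p : ℝ) then 1 / (∏ p ∈ (Finset.range ⌈Real.exp (Real.log (Real.log (x : ℝ)) ^ 2)⌉₊).filter Nat.Prime, (1 - 1 / (p : ℝ))) else 0) n) x - (x : ℝ)| ≤ δ * (x : ℝ) := by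
    intro δ hδ
    obtain ⟨x₀, hx₀⟩ := stub_roughMass δ hδ
    exact ⟨x₀, fun x hx => hx₀ x hx _ _ _ rfl rfl rfl⟩
  have hL : ∀ δ : ℝ, 0 < δ → ∃ x₀ : ℕ, ∀ x : ℕ, x₀ ≤ x →
      |(fun x : ℕ => ∑ n ∈ Finset.Ioc x (2 * x), (fun n : ℕ => if ∀ p ∈ n.primeFactors, Real.exp (Real.log (Real.log (x : ℝ)) ^ 2) ≤ (p : ℝ) then 1 / (∏ p ∈ (Finset.range ⌈Real.exp (Real.log (Real.log (x : ℝ)) ^ 2)⌉₊).filter Nat.Prime, (1 - 1 / (p : ℝ))) else 0) n * (ArithmeticFunction.liouville (n + 2) : ℝ)) x| ≤ δ * (x : ℝ) := by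
    intro δ hδ
    obtain ⟨x₀, hx₀⟩ := stub_roughLiouville δ hδ
    exact ⟨x₀, fun x hx => hx₀ x hx _ _ _ rfl rfl rfl⟩
  have hP : ∃ ε₁ : ℝ, 0 < ε₁ ∧ ∀ ε : ℝ, 0 < ε → ε ≤ ε₁ → ∃ c₀ : ℝ, 0 < c₀ ∧ ∃ x₀ : ℕ, ∀ x : ℕ,
      x₀ ≤ x → c₀ * (x : ℝ) / Real.log (x : ℝ) ≤ (fun (ε : ℝ) (x : ℕ) => ∑ n ∈ Finset.Ioc x (2 * x), (fun n : ℕ => if ∀ p ∈ n.primeFactors, Real.exp (Real.log (Real.log (x : ℝ)) ^ 2) ≤ (p : ℝ) then 1 / (∏ p ∈ (Finset.range ⌈Real.exp (Real.log (Real.log (x : ℝ)) ^ 2)⌉₊).filter Nat.Prime, (1 - 1 / (p : ℝ))) else 0) n * (ArithmeticFunction.liouville (n + 2) : ℝ) * (fun m : ℕ => if (x : ℝ) ^ (ε ^ 2) ≤ (m.minFac : ℝ) ∧ (m.minFac : ℝ) < (x : ℝ) ^ ((1 : ℝ) / 5) then ∑ d ∈ (Nat.divisors m).filter (fun d : ℕ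 => (d : ℝ) ≤ (x : ℝ) ^ ((1 : ℝ) / 2 - 2 * ε) ∧ ∀ p ∈ d.primeFactors, (x : ℝ) ^ ((1 : ℝ) / 5) ≤ (p : ℝ)), (ArithmeticFunction.moebius d : ℝ) else 0) (n + 2)) ε x := by
    obtain ⟨ε₁, hε₁, h⟩ := calibrationLowerBound_of_twisted hA
    refine ⟨ε₁, hε₁, fun ε hε hεle => ?_⟩
    obtain ⟨c₀, hc₀, x₀, hx₀⟩ := h ε hε hεle
    exact ⟨c₀, hc₀, x₀, fun x hx => hx₀ x hx _ _ _ _ rfl rfl rfl rfl⟩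
  have hWl : ∀ x : ℕ, (fun x : ℕ => ∑ n ∈ Finset.Ioc x (2 * x), (ArithmeticFunction.liouville (n + 2) : ℝ) * ((fun n : ℕ => if n.Prime then Real.log (n : ℝ) else 0) n - (fun n : ℕ => if ∀ p ∈ n.primeFactors, Real.exp (Real.log (Real.log (x : ℝ)) ^ 2) ≤ (p : ℝ) then 1 / (∏ p ∈ (Finset.range ⌈Real.exp (Real.log (Real.log (x : ℝ)) ^ 2)⌉₊).filter Nat.Prime, (1 - 1 / (p : ℝ))) else 0) n)) x = (fun x : ℕ => ∑ p ∈ (Finset.Ioc x (2 * x)).filter Nat.Prime, Real.log (p : ℝ) * (ArithmeticFunction.liouville (p + 2) : ℝ)) x - (fun x : ℕ => ∑ n ∈ Finset.Ioc x (2 * x), (fun n : ℕ => if ∀ p ∈ n.primeFactors, Real.exp (Real.log (Real.log (x : ℝ)) ^ 2) ≤ (p : ℝ) then 1 / (∏ p ∈ (Finset.range ⌈Real.exp (Real.log (Real.log (x : ℝ)) ^ 2)⌉₊).filter Nat.Prime, (1 - 1 / (p : ℝ))) else 0) n * (ArithmeticFunction.liouville (n + 2) : ℝ)) x := by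
    intro x
    simp only
    rw [Finset.sum_filter, ← Finset.sum_sub_distrib]
    refine Finset.sum_congr rfl fun n _ => ?_
    split_ifs <;> ring
  exact assembly_abstract (W := (fun (ε : ℝ) (x : ℕ) => ∑ n ∈ Finset.Ioc x (2 * x), (fun m : ℕ => if (x : ℝ) ^ (ε ^ 2) ≤ (m.minFac : ℝ) ∧ (m.minFac : ℝ) < (x : ℝ) ^ ((1 : ℝ) / 5) then ∑ d ∈ (Nat.divisors m).filter (fun d : ℕ => (d : ℝ) ≤ (x : ℝ) ^ ((1 : ℝ) / 2 - 2 * ε) ∧ ∀ p ∈ d.primeFactors, (x : ℝ) ^ ((1 : ℝ) / 5) ≤ (p : ℝ)), (ArithmeticFunction.moebius d : ℝ) else 0) (n + 2) * ((fun n : ℕ => if n.Prime then Real.log (n : ℝ) else 0) n - (fun n : ℕ => if ∀ p ∈ n.primeFactors, Real.exp (Real.log (Real.log (x : ℝ)) ^ 2) ≤ (p : ℝ) then 1 / (∏ p ∈ (Finset.range ⌈Real.exp (Real.log (Real.log (x : ℝ)) ^ 2)⌉₊).filter Nat.Prime, (1 - 1 / (p : ℝ))) else 0) n))) (P := (fun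 (ε : ℝ) (x : ℕ) => ∑ n ∈ Finset.Ioc x (2 * x), (fun n : ℕ => if ∀ p ∈ n.primeFactors, Real.exp (Real.log (Real.log (x : ℝ)) ^ 2) ≤ (p : ℝ) then 1 / (∏ p ∈ (Finset.range ⌈Real.exp (Real.log (Real.log (x : ℝ)) ^ 2)⌉₊).filter Nat.Prime, (1 - 1 / (p : ℝ))) else 0) n * (ArithmeticFunction.liouville (n + 2) : ℝ) * (fun m : ℕ => if (x : ℝ) ^ (ε ^ 2) ≤ (m.minFac : ℝ) ∧ (m.minFac : ℝ) < (x : ℝ) ^ ((1 : ℝ) / 5) then ∑ d ∈ (Nat.divisors m).filter (fun d : ℕ => (d : ℝ) ≤ (x : ℝ) ^ ((1 : ℝ) / 2 - 2 * ε) ∧ ∀ p ∈ d.primeFactors, (x : ℝ) ^ ((1 : ℝ) / 5) ≤ (p : ℝ)), (ArithmeticFunction.moebius d : ℝ) else 0) (n + 2))) (Bf := (fun x : ℕ => ∑ n ∈ Finset.Ioc x (2 * x), (fun n : ℕ => if ∀ p ∈ n.primeFactors, Real.exp (Real.log (Real.log (x : ℝ)) ^ 2) ≤ (p : ℝ) then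 1 / (∏ p ∈ (Finset.range ⌈Real.exp (Real.log (Real.log (x : ℝ)) ^ 2)⌉₊).filter Nat.Prime, (1 - 1 / (p : ℝ))) else 0) n)) (Wlf := (fun x : ℕ => ∑ n ∈ Finset.Ioc x (2 * x), (ArithmeticFunction.liouville (n + 2) : ℝ) * ((fun n : ℕ => if n.Prime then Real.log (n : ℝ) else 0) n - (fun n : ℕ => if ∀ p ∈ n.primeFactors, Real.exp (Real.log (Real.log (x : ℝ)) ^ 2) ≤ (p : ℝ) then 1 / (∏ p ∈ (Finset.range ⌈Real.exp (Real.log (Real.log (x : ℝ)) ^ 2)⌉₊).filter Nat.Prime, (1 - 1 / (p : ℝ))) else 0) n))) (Sf := (fun x : ℕ => ∑ p ∈ (Finset.Ioc x (2 * x)).filter Nat.Prime, Real.log (p : ℝ) * (ArithmeticFunction.liouville (p + 2) : ℝ))) (Lf := (fun x : ℕ => ∑ n ∈ Finset.Ioc x (2 * x), (fun n : ℕ => if ∀ p ∈ n.primeFactors, Real.exp (Real.log (Real.log (x : ℝ)) ^ 2) ≤ (p : ℝ) then 1 / (∏ p ∈ (Finset.range ⌈Real.exp (Real.log (Real.log (x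 : ℝ)) ^ 2)⌉₊).filter Nat.Prime, (1 - 1 / (p : ℝ))) else 0) n * (ArithmeticFunction.liouville (n + 2) : ℝ))) hWl hB hL hP hK2 hK1

end Summit.Parity.GeneralizedHardyLittlewood.Theorems.ParityLeakOneFifth
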